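import Summits.HodgeConjecture.HodgeConjecture.Theorems.R90S4TypeOneTorusClasses               -- ★ p864140 F3a (this seat): `eq_of_unitary_conj_realisers`, `exists_realiser_unitary_conj_of_isStablyConjGAt`, `conj_mem_unitaryGroup_of_mem_centralizer`, §1 plumbing
import Summits.HodgeConjecture.HodgeConjecture.Theorems.R90S4StableTransportDictTrivialTypes  -- ★ (K2E3-p12): the `hmem` shape of `isStableTransportDict_of_forall_member`, `mk_mem_stableIndexSet`; brings ★ `cartanWeight_eq_of_isStablyConjGAt`, `cartanWeight`
import Summits.HodgeConjecture.HodgeConjecture.Theorems.F0P3cStCharTSHyperbolicSetEigen        -- ★ `exists_isRoot_of_mem_hyperbolicSet` (`γ ∈ Ω ⇒` an eigenvalue off the norm-one torus)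
import Literature.NumberTheory.Rogawski1990.CartanTorusTransport                               -- ★ `centralizer_singleton_conj_eq_map` (`Z(uδu⁻¹) = u Z(δ) u⁻¹`)
import HarnessLib

/-!
# R90-TF · S4 «Ch. 13.1–2», (DICT)(1) file F3b — THE TYPE-(1) MEMBER PACKAGE of the stable-transport dictionary (Rogawski 1990, §3.5 Prop. 3.5.2, §3.6 (1), §12.5 p. 182)

Cell `hodgecm-mathlib`, crux H413 (`stmt-HodgeConjecture-24833`, lane `--supports … --as helper`), route of record `HCCMUnconditional` (no route verbs; count-neutral).
Programme R90-TF, section S4 (base `R90-C131`), dealer K2E2-plan (g7), hand (DICT)(1) «`(E¹)³` TYPE» (GO 2026-09-05T01:10:20Z); seat R90-C131-p01 (g2).  THEOREMS ONLY; ★-only imports.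

## THE MATHEMATICS
`G_v = Gqs L v = U(Φ₃)(L⁺_v)`, `v` NON-SPLIT, `C` a Cartan system (★ CARTAN-ALL: every regular centraliser is `G_v`-conjugate into a member), `T_i = Z(γ₀) ∈ C` with `γ₀` of TYPE (1):
`char(γ₀) = ∏ₖ (X − uₖ)`, `u` injective, `σ(uₖ)uₖ = 1` (`Z(γ₀) ≅ (E¹_w)³`).  THE PACKAGE (the `hmem` input of ★ `isStableTransportDict_of_forall_member` at `T_i`, with `k = 4 = |𝔇(T∕F)|`):
(§3) pick an eigenframe `P` and four REALISERS `g_j ∈ GL₃(L_w)` (`g_j γ₀ g_j⁻¹ ∈ U`) whose norm tests read the four sum-zero sign rows `(0,0,0), (0,1,1), (1,0,1), (1,1,0)` (★ (L4a)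
`exists_eigenframe_and_forall_exists_conj_mem_of_charpoly`); `δ_j := g_j γ₀ g_j⁻¹ ∈ G_v` is regular, so (CARTAN-ALL) `Z(δ_j) = x_j T_j x_j⁻¹` for a member `T_j =: τ j` and some `x_j ∈ G_v`;
with `y_j := x_j⁻¹ g_j` one has `y_j γ₀ y_j⁻¹ = x_j⁻¹ δ_j x_j =: δ′_j`, `Z(δ′_j) = T_j`, and the TRANSPORT `e_j : T_i = Z(γ₀) ≃ₜ* Z(δ′_j) = T_j`, `t ↦ y_j t y_j⁻¹`, is the
conjugator-independent isomorphism of ★ `UnitaryGroup.localStableCentralizerEquiv` (§4.3).  Clauses: (S) `e_j t = y_j t y_j⁻¹ ∼_{st} t`; (W) `T_i, T_j` are compact (type (1) is not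
hyperbolic: every eigenvalue is on the norm-one torus, ★ `exists_isRoot_of_mem_hyperbolicSet`; ★ «ELL-CARTAN-COMPACT»; compactness is a stable invariant, ★
`isCompact_centralizer_iff_of_isStablyConjGAt`), hence `≠ M` (★ `not_isCompact_cmTorus`), and ★ `cartanWeight_eq_of_isStablyConjGAt` applies; (B) `⟦e_j t⟧ = ⟦g_j t g_j⁻¹⟧` (conjugate
by `x_j ∈ G_v`), so on `T_i^{reg}` the map `j ↦ ⟦e_j t⟧` is injective (★ F3a `eq_of_unitary_conj_realisers`) and onto `{c | t ∼_{st} out c}` (★ F3a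
`exists_realiser_unitary_conj_of_isStablyConjGAt`) — «`Φ^{st}(t) = Σ_{δ ∈ 𝔇(T∕F)} Φ(t^δ)`, `|𝔇(T∕F)| = 4`» [§3.6 (1), p. 182].  The sign rows, frame, realisers, `x_j` and `δ_j` are
EXPOSED (last conjunct) for the (C)-clause hand (p05, F4: which member `τ j` is).

## CONTENTS
* §1 the sign table: `typeOneSign_sum_eq_zero`, `typeOneSign_injective`, `exists_typeOneSign_eq`.
* §2 `not_mem_hyperbolicSet_of_charpoly_eq_prod`, `isCompact_centralizer_of_charpoly_eq_prod` (type (1) centralisers are compact); `exists_centralizerEquiv_coe_eq_conj` (the transport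
  `Z(γ₀) ≃ₜ* Z(δ)` as an element of `A ≃ₜ* B` for `A = Z(γ₀)`, `Z(δ) = B`, with its value `t ↦ y t y⁻¹`).
* §3 `exists_typeOne_memberPackage` — THE PACKAGE `(τ, e)` with (S), (W), (B) and the exposed data.

HONEST LABEL: HC_CM is proved only modulo the 7 printed citations (2 remaining named inputs: hLiu418 = stmt-HodgeConjecture-24832, h413 = stmt-HodgeConjecture-24833) until rung 0
closes.  Input of ★ (B2-S) `isStableTransportDict_of_forall_member` behind the OPEN (W-NP); discharges no named input; the fibre counts ∕ (C) clause are NOT in this file.  REL ≠ ★ ≠ BUILT.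

## References
* [Rogawski1990] J. D. Rogawski, *Automorphic Representations of Unitary Groups in Three Variables*, Ann. of Math. Stud. 123 (1990), §3.5 Prop. 3.5.2 (a)(c) p. 29, §3.6 pp. 28–31,
  §4.3 pp. 43–44, §12.5 p. 182.
* [Kottwitz1986] R. E. Kottwitz, *Stable trace formula: elliptic singular terms*, Math. Ann. 275 (1986), §7.
-/

set_option autoImplicit false
set_option linter.dupNamespace false

noncomputable section

open NumberField IsDedekindDomain Polynomial Matrix
open scoped MatrixGroups
open Literature.NumberTheory.Rogawski1990 Literature.NumberTheory.Automorphic Literature.NumberTheory.Automorphic.UnitaryGroup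
open Literature.AlgebraicGeometry.ShimuraVarieties (unitaryGroup mem_unitaryGroup_iff)
open Summit.HodgeConjecture.HodgeConjecture.Cruxes.H413

namespace Summit.HodgeConjecture.HodgeConjecture.R90.S4

/-! ## §1 The sign table `𝔇(T∕F) ≅ {ε ∈ (ℤ∕2)³ : Σ εᵢ = 0}` listed -/

/-- The rows of the type-(1) sign table sum to zero. [cite: Rogawski1990, §3.6 p. 31] -/
theorem typeOneSign_sum_eq_zero (j : Fin 4) : ∑ i, (![![0, 0, 0], ![0, 1, 1], ![1, 0, 1], ![1, 1, 0]] : Fin 4 → Fin 3 → ZMod 2) j i = 0 := by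
  revert j
  simp only [Fin.sum_univ_three]
  decide

/-- The rows of the type-(1) sign table are pairwise distinct. [cite: Rogawski1990, §3.6 p. 31] -/
theorem typeOneSign_injective (j k : Fin 4) (h : ∀ i, (![![0, 0, 0], ![0, 1, 1], ![1, 0, 1], ![1, 1, 0]] : Fin 4 → Fin 3 → ZMod 2) j i =
    (![![0, 0, 0], ![0, 1, 1], ![1, 0, 1], ![1, 1, 0]] : Fin 4 → Fin 3 → ZMod 2) k i) : j = k := by
  have key : ∀ j k : Fin 4, (![![0, 0, 0], ![0, 1, 1], ![1, 0, 1], ![1, 1, 0]] : Fin 4 → Fin 3 → ZMod 2) j 0 =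
      (![![0, 0, 0], ![0, 1, 1], ![1, 0, 1], ![1, 1, 0]] : Fin 4 → Fin 3 → ZMod 2) k 0 →
      (![![0, 0, 0], ![0, 1, 1], ![1, 0, 1], ![1, 1, 0]] : Fin 4 → Fin 3 → ZMod 2) j 1 =
      (![![0, 0, 0], ![0, 1, 1], ![1, 0, 1], ![1, 1, 0]] : Fin 4 → Fin 3 → ZMod 2) k 1 → j = k := by
    decide
  exact key j k (h 0) (h 1)

/-- The rows of the type-(1) sign table exhaust the sum-zero sign vectors. [cite: Rogawski1990, §3.6 p. 31] -/
theorem exists_typeOneSign_eq (e : Fin 3 → ZMod 2) (he : e 0 + e 1 + e 2 = 0) :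
    ∃ j : Fin 4, ∀ i, (![![0, 0, 0], ![0, 1, 1], ![1, 0, 1], ![1, 1, 0]] : Fin 4 → Fin 3 → ZMod 2) j i = e i := by
  have key : ∀ a b c : ZMod 2, a + b + c = 0 → ∃ j : Fin 4, (![![0, 0, 0], ![0, 1, 1], ![1, 0, 1], ![1, 1, 0]] : Fin 4 → Fin 3 → ZMod 2) j 0 = a ∧
      (![![0, 0, 0], ![0, 1, 1], ![1, 0, 1], ![1, 1, 0]] : Fin 4 → Fin 3 → ZMod 2) j 1 = b ∧
      (![![0, 0, 0], ![0, 1, 1], ![1, 0, 1], ![1, 1, 0]] : Fin 4 → Fin 3 → ZMod 2) j 2 = c := by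
    decide
  obtain ⟨j, h0, h1, h2⟩ := key (e 0) (e 1) (e 2) he
  refine ⟨j, fun i => ?_⟩
  fin_cases i
  exacts [h0, h1, h2]

section TypeOnePackage

variable (L : Type) [Field L] [NumberField L] [IsCMField L] (v : HeightOneSpectrum (𝓞 ↥(maximalRealSubfield L)))

variable {L v}

/-! ## §2 Type-(1) centralisers are compact; the transport along a stable conjugation -/

/-- **TYPE (1) IS NOT HYPERBOLIC** (`v` non-split): if `char(γ₀) = ∏ₖ (X − uₖ)` with every `uₖ` on the norm-one torus (`σ(uₖ)uₖ = 1`), then `γ₀ ∉ Ω` — an element of `Ω` has an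
eigenvalue `α` with `α σ(α) ≠ 1` (★ `exists_isRoot_of_mem_hyperbolicSet`), but every root of `∏ₖ (X − uₖ)` over the field `L_w` is some `uₖ`. [cite: Rogawski1990, §3.6 pp. 30–31; §12.5 p. 182] -/
theorem not_mem_hyperbolicSet_of_charpoly_eq_prod (hns : ∀ w : PlacesOver L v, IsCMField.complexConj L • w.1 = w.1) {γ₀ : Gqs L v} {u : Fin 3 → LocalRing L v}
    (hu1 : ∀ k, conjLocal L (IsCMField.complexConj L) v (u k) * u k = 1) (hchar : γ₀.val.val.charpoly = ∏ k, (X - C (u k))) :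
    γ₀ ∉ F0P3cStCharTSTorusDefs.hyperbolicSet L v := by
  intro hΩ
  obtain ⟨w⟩ := (inferInstance : Nonempty (PlacesOver L v))
  letI : Field (LocalRing L v) := (LocalRing.isField_of_smul_eq (IsCMField.complexConj L) (IsCMField.complexConj_ne_one L) w (hns w)).toField
  obtain ⟨α, hα, hne⟩ := F0P3cStCharTSHyperbolicSetEigen.exists_isRoot_of_mem_hyperbolicSet L v hΩ
  have hα' : (∏ k, (X - C (u k))).IsRoot α := by rw [← hchar]; exact hα
  rw [Polynomial.IsRoot, Polynomial.eval_prod, Finset.prod_eq_zero_iff] at hα'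
  obtain ⟨k, -, hk⟩ := hα'
  rw [eval_sub, eval_X, eval_C, sub_eq_zero] at hk
  exact hne (by rw [hk, mul_comm]; exact hu1 k)

/-- **TYPE (1) CENTRALISERS ARE COMPACT** (`v` non-split): `Z_{G_v}(γ₀)` is compact for `γ₀` with `char(γ₀) = ∏ₖ (X − uₖ)`, `u` injective, `σ(uₖ)uₖ = 1` (★ «ELL-CARTAN-COMPACT»
`isCompact_centralizer_of_not_mem_hyperbolicSet` + §2). [cite: Rogawski1990, §3.6 pp. 30–31; §12.5 p. 184] -/
theorem isCompact_centralizer_of_charpoly_eq_prod (hns : ∀ w : PlacesOver L v, IsCMField.complexConj L • w.1 = w.1) {γ₀ : Gqs L v} {u : Fin 3 → LocalRing L v}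
    (hu : Function.Injective u) (hu1 : ∀ k, conjLocal L (IsCMField.complexConj L) v (u k) * u k = 1) (hchar : γ₀.val.val.charpoly = ∏ k, (X - C (u k))) :
    IsCompact ((Subgroup.centralizer ({γ₀} : Set (Gqs L v))) : Set (Gqs L v)) := by
  obtain ⟨w⟩ := (inferInstance : Nonempty (PlacesOver L v))
  letI : Field (LocalRing L v) := (LocalRing.isField_of_smul_eq (IsCMField.complexConj L) (IsCMField.complexConj_ne_one L) w (hns w)).toField
  have hreg : IsRegularElt (γ₀.val : GL (Fin 3) (LocalRing L v)) := by
    rw [isRegularElt_iff, hchar]; exact separable_prod_X_sub_C_iff.2 hu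
  exact F0P3cStCharTSEllCartanCompact.isCompact_centralizer_of_not_mem_hyperbolicSet L v hns hreg (not_mem_hyperbolicSet_of_charpoly_eq_prod hns hu1 hchar)

/-- **THE TRANSPORT ALONG A STABLE CONJUGATION, AS AN ISOMORPHISM OF MEMBERS**: for `γ₀ ∈ G_v` regular, `y ∈ GL₃(L_w)` with `y γ₀ y⁻¹ = δ ∈ G_v`, and subgroups `A = Z(γ₀)`, `Z(δ) = B`,
there is `e : A ≃ₜ* B` with `e t = y t y⁻¹` (★ `UnitaryGroup.localStableCentralizerEquiv`, conjugator-independent; value by ★ `coe_localStableCentralizerEquiv_eq_of_conj_eq`).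
[cite: Rogawski1990, §4.3 pp. 43–44; §3.6 p. 31] -/
theorem exists_centralizerEquiv_coe_eq_conj {γ₀ δ : Gqs L v} (hreg : IsRegularElt (γ₀.val : GL (Fin 3) (LocalRing L v)))
    {y : GL (Fin 3) (LocalRing L v)} (hy : y * γ₀.val * y⁻¹ = δ.val) {A B : Subgroup (Gqs L v)}
    (hA : A = Subgroup.centralizer ({γ₀} : Set (Gqs L v))) (hB : Subgroup.centralizer ({δ} : Set (Gqs L v)) = B) :
    ∃ e : ↥A ≃ₜ* ↥B, ∀ t : ↥A, ((e t : ↥B) : Gqs L v).val = y * (t : Gqs L v).val * y⁻¹ := by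
  subst hA hB
  have hdet : ((R90.S4.splitFormGL L : GL (Fin 3) L) : Matrix (Fin 3) (Fin 3) L).det ≠ 0 := (Matrix.isUnits_det_units _).ne_zero
  have hst : IsStablyConjGAt L (R90.S4.splitFormGL L) v γ₀ δ := (isStablyConjGAt_iff_exists_conj_eq γ₀ δ).2 ⟨y, hy⟩
  exact ⟨UnitaryGroup.localStableCentralizerEquiv L v hdet hdet hst hreg, fun t =>
    UnitaryGroup.coe_localStableCentralizerEquiv_eq_of_conj_eq L v hdet hdet hst hreg y hy t⟩

/-! ## §3 The type-(1) member package -/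

set_option maxHeartbeats 800000 in  -- statement-level `whnf` on the CM carriers (`Gqs`, `LocalRing`), as in ★ `F0P3cStCharTSHyperbolicSetEigen`
/-- **THE TYPE-(1) MEMBER PACKAGE** (`v` non-split).  Let `C` (binder `Car`; `C` is `Polynomial.C` in this file) be a Cartan system of `G_v` (covering letter of ★ CARTAN-ALL: every regular centraliser is `x T x⁻¹` for a member `T` and
some `x ∈ G_v`) and `T_i = Z(γ₀) ∈ C` with `γ₀` of type (1) (`char(γ₀) = ∏ₖ (X − uₖ)`, `u` injective, `σ(uₖ)uₖ = 1`).  Then there are FOUR targets `τ : Fin 4 → C` and transports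
`e j : T_i ≃ₜ* T_{τ j}` with: (S) `e j t ∼_{st} t`; (W) `D_{T_{τ j}}(e j t) = D_{T_i}(t)` on `T_i^{reg}`; (B) for regular `t ∈ T_i`, `j ↦ ⟦e j t⟧` is a bijection from `Fin 4` onto
`{c | t ∼_{st} out c}` («`|𝔇(T∕F)| = 4` classes in the stable class, uniformly along `T^{reg}`»); and (DATA) an eigenframe `P` of `γ₀`, realisers `g j` (`g_j γ₀ g_j⁻¹ ∈ U`) whose norm
tests read the sign rows `(0,0,0), (0,1,1), (1,0,1), (1,1,0)`, elements `x j ∈ G_v` and `δ j = g_j γ₀ g_j⁻¹ ∈ G_v` with `Z(δ j) = x_j T_{τ j} x_j⁻¹`, and the formula `e j t = y_j t y_j⁻¹`,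
`y_j = x_j⁻¹ g_j`.  This is the `hmem` input (with `k = μ i = 4`) of ★ `isStableTransportDict_of_forall_member` at a type-(1) member, up to the fibre counts of `τ`.
[cite: Rogawski1990, §3.5 Prop. 3.5.2 (a)(c) p. 29; §3.6 pp. 30–31; §4.3 pp. 43–44; §12.5 p. 182] [cite: Kottwitz1986, §7] -/
theorem exists_typeOne_memberPackage (hns : ∀ w : PlacesOver L v, IsCMField.complexConj L • w.1 = w.1) {Car : Finset (Subgroup (Gqs L v))} (i : ↥Car)
    {γ₀ : Gqs L v} {u : Fin 3 → LocalRing L v} (hu : Function.Injective u) (hu1 : ∀ k, conjLocal L (IsCMField.complexConj L) v (u k) * u k = 1)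
    (hchar : γ₀.val.val.charpoly = ∏ k, (X - C (u k))) (hi : (i : Subgroup (Gqs L v)) = Subgroup.centralizer ({γ₀} : Set (Gqs L v)))
    (hcov : ∀ γ : Gqs L v, IsRegularElt (γ.val : GL (Fin 3) (LocalRing L v)) →
      ∃ T ∈ Car, ∃ x : Gqs L v, Subgroup.centralizer ({γ} : Set (Gqs L v)) = T.map (MulAut.conj x).toMonoidHom) :
    ∃ (τ : Fin 4 → ↥Car) (e : ∀ j : Fin 4, ↥(i : Subgroup (Gqs L v)) ≃ₜ* ↥((τ j : ↥Car) : Subgroup (Gqs L v))),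
      (∀ (j : Fin 4) (t : ↥(i : Subgroup (Gqs L v))),
          IsStablyConjGAt L (R90.S4.splitFormGL L) v (t : Gqs L v) ((e j t : ↥((τ j : ↥Car) : Subgroup (Gqs L v))) : Gqs L v)) ∧
      (∀ (j : Fin 4) (t : ↥(i : Subgroup (Gqs L v))), IsRegularElt (((t : Gqs L v)).val : GL (Fin 3) (LocalRing L v)) →
          cartanWeight L v ((τ j : ↥Car) : Subgroup (Gqs L v)) (e j t) = cartanWeight L v (i : Subgroup (Gqs L v)) t) ∧
      (∀ t : ↥(i : Subgroup (Gqs L v)), IsRegularElt (((t : Gqs L v)).val : GL (Fin 3) (LocalRing L v)) →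
          Set.BijOn (fun j : Fin 4 => ConjClasses.mk ((e j t : ↥((τ j : ↥Car) : Subgroup (Gqs L v))) : Gqs L v)) Set.univ
            {c : ConjClasses (Gqs L v) | IsStablyConjGAt L (R90.S4.splitFormGL L) v (t : Gqs L v) (Quotient.out c)}) ∧
      (∃ (P : GL (Fin 3) (LocalRing L v)) (g : Fin 4 → GL (Fin 3) (LocalRing L v)) (x δ : Fin 4 → Gqs L v),
        γ₀.val.val * P.val = P.val * diagonal u ∧
        (∀ j, g j * γ₀.val * (g j)⁻¹ ∈ unitaryGroup (conjLocal L (IsCMField.complexConj L) v) (cmLocalForm L 3 v)) ∧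
        (∀ j k, (∃ z : LocalRing L v, IsUnit z ∧
            twistGram (conjLocal L (IsCMField.complexConj L) v) (cmLocalForm L 3 v) ((g j).val * P.val) k k =
              conjLocal L (IsCMField.complexConj L) v z * z * twistGram (conjLocal L (IsCMField.complexConj L) v) (cmLocalForm L 3 v) P.val k k) ↔
          (![![0, 0, 0], ![0, 1, 1], ![1, 0, 1], ![1, 1, 0]] : Fin 4 → Fin 3 → ZMod 2) j k = 0) ∧
        (∀ j, (δ j).val = g j * γ₀.val * (g j)⁻¹) ∧
        (∀ j, Subgroup.centralizer ({δ j} : Set (Gqs L v)) = ((τ j : ↥Car) : Subgroup (Gqs L v)).map (MulAut.conj (x j)).toMonoidHom) ∧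
        (∀ (j : Fin 4) (t : ↥(i : Subgroup (Gqs L v))),
          ((e j t : ↥((τ j : ↥Car) : Subgroup (Gqs L v))) : Gqs L v).val = ((x j).val⁻¹ * g j) * (t : Gqs L v).val * ((x j).val⁻¹ * g j)⁻¹)) := by
  classical
  obtain ⟨w⟩ := (inferInstance : Nonempty (PlacesOver L v))
  obtain ⟨δL, hcδ, hδL⟩ := Literature.NumberTheory.Weil1982.UnitaryFinTopForm.exists_complexConj_eq_neg_ne_zero L
  letI : Field (LocalRing L v) := (LocalRing.isField_of_smul_eq (IsCMField.complexConj L) (IsCMField.complexConj_ne_one L) w (hns w)).toField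
  have hH : IsUnit (cmLocalForm L 3 v).det := by
    rw [cmLocalForm_eq_over]; exact (Matrix.isUnit_iff_isUnit_det _).1 ((StdForm.antidiagonal 3).isUnit_over _)
  have hHh : ((cmLocalForm L 3 v).map (conjLocal L (IsCMField.complexConj L) v))ᵀ = cmLocalForm L 3 v := by
    rw [cmLocalForm_eq_over, StdForm.over_map, StdForm.transpose_over]
  have hγU : γ₀.val ∈ unitaryGroup (conjLocal L (IsCMField.complexConj L) v) (cmLocalForm L 3 v) := by
    rw [← unitaryGroupOfForm_cmLocalForm_eq_unitaryGroup]; exact γ₀.2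
  have hreg₀ : IsRegularElt (γ₀.val : GL (Fin 3) (LocalRing L v)) := by
    rw [isRegularElt_iff, hchar]; exact separable_prod_X_sub_C_iff.2 hu
  -- §3 (a): eigenframe and the four realisers
  obtain ⟨P, hP, hreal⟩ := exists_eigenframe_and_forall_exists_conj_mem_of_charpoly L v (IsCMField.complexConj L) hcδ hδL w (hns w) hHh hH hγU u hu hu1 hchar
  choose g hgU hgNT using fun j : Fin 4 => hreal (fun k => (![![0, 0, 0], ![0, 1, 1], ![1, 0, 1], ![1, 1, 0]] : Fin 4 → Fin 3 → ZMod 2) j k) (typeOneSign_sum_eq_zero j)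
  -- §3 (b): the regular elements `δ_j = g_j γ₀ g_j⁻¹ ∈ G_v` and their member tori
  have hδU : ∀ j, g j * γ₀.val * (g j)⁻¹ ∈ unitaryGroupOfForm (conjLocal L (IsCMField.complexConj L) v) (cmLocalForm L 3 v) := by
    intro j; rw [unitaryGroupOfForm_cmLocalForm_eq_unitaryGroup]; exact hgU j
  have hδex : ∀ j, ∃ d : Gqs L v, d.val = g j * γ₀.val * (g j)⁻¹ := fun j => ⟨⟨g j * γ₀.val * (g j)⁻¹, hδU j⟩, rfl⟩
  choose δ hδval using hδex
  have hδreg : ∀ j, IsRegularElt ((δ j).val : GL (Fin 3) (LocalRing L v)) := fun j => by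
    rw [hδval]; exact isRegularElt_of_isConj (isConj_iff.2 ⟨g j, rfl⟩) hreg₀
  choose T hTC x hTx using fun j => hcov (δ j) (hδreg j)
  -- §3 (c): `δ′_j = x_j⁻¹ δ_j x_j`, `Z(δ′_j) = T_j`, `y_j = x_j⁻¹ g_j`
  have hδ'ex : ∀ j, ∃ d' : Gqs L v, d' = (x j)⁻¹ * δ j * x j := fun j => ⟨_, rfl⟩
  choose δ' hδ'def using hδ'ex
  have hZ' : ∀ j, Subgroup.centralizer ({δ' j} : Set (Gqs L v)) = T j := by
    intro j
    have h1 : x j * δ' j * (x j)⁻¹ = δ j := by rw [hδ'def]; group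
    have h2 : (Subgroup.centralizer ({δ' j} : Set (Gqs L v))).map (MulAut.conj (x j)).toMonoidHom = (T j).map (MulAut.conj (x j)).toMonoidHom := by
      rw [← centralizer_singleton_conj_eq_map, h1, hTx]
    exact Subgroup.map_injective (MulAut.conj (x j)).injective h2
  have hδ'val : ∀ j, (δ' j).val = (x j).val⁻¹ * (δ j).val * (x j).val := fun j => by rw [hδ'def]; rfl
  have hy : ∀ j, ((x j).val⁻¹ * g j) * γ₀.val * ((x j).val⁻¹ * g j)⁻¹ = (δ' j).val := by
    intro j; rw [hδ'val, hδval]; group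
  have hst : ∀ j, IsStablyConjGAt L (R90.S4.splitFormGL L) v γ₀ (δ' j) := fun j => (isStablyConjGAt_iff_exists_conj_eq γ₀ (δ' j)).2 ⟨_, hy j⟩
  -- the transports
  have hex : ∀ j, ∃ e : ↥(i : Subgroup (Gqs L v)) ≃ₜ* ↥((⟨T j, hTC j⟩ : ↥Car) : Subgroup (Gqs L v)),
      ∀ t : ↥(i : Subgroup (Gqs L v)), ((e t : ↥((⟨T j, hTC j⟩ : ↥Car) : Subgroup (Gqs L v))) : Gqs L v).val =
        ((x j).val⁻¹ * g j) * (t : Gqs L v).val * ((x j).val⁻¹ * g j)⁻¹ :=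
    fun j => exists_centralizerEquiv_coe_eq_conj hreg₀ (hy j) hi (hZ' j)
  choose e he using hex
  -- compactness: `T_i` and the `T_j` are compact, hence `≠ M`
  have hZc : IsCompact ((Subgroup.centralizer ({γ₀} : Set (Gqs L v))) : Set (Gqs L v)) := isCompact_centralizer_of_charpoly_eq_prod hns hu hu1 hchar
  have hic : IsCompact (((i : Subgroup (Gqs L v))) : Set (Gqs L v)) := by rw [hi]; exact hZc
  have hτc : ∀ j, IsCompact ((T j : Subgroup (Gqs L v)) : Set (Gqs L v)) := by
    intro j
    have hiff : IsCompact ((Subgroup.centralizer ({γ₀} : Set (Gqs L v))) : Set (Gqs L v)) ↔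
        IsCompact ((Subgroup.centralizer ({δ' j} : Set (Gqs L v))) : Set (Gqs L v)) :=
      isCompact_centralizer_iff_of_isStablyConjGAt (Φ := R90.S4.splitFormGL L) hreg₀ (hst j)
    rw [← hZ' j]; exact hiff.1 hZc
  have hiM : (i : Subgroup (Gqs L v)) ≠ (cmBorelTriple L 3 v).M := by
    intro h; rw [h] at hic; exact F0P3cStCharTSCartanFields.not_isCompact_cmTorus L v hic
  have hτM : ∀ j, (T j : Subgroup (Gqs L v)) ≠ (cmBorelTriple L 3 v).M := by
    intro j h; have h' := hτc j; rw [h] at h'; exact F0P3cStCharTSCartanFields.not_isCompact_cmTorus L v h'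
  -- (S)
  have hS : ∀ (j : Fin 4) (t : ↥(i : Subgroup (Gqs L v))),
      IsStablyConjGAt L (R90.S4.splitFormGL L) v (t : Gqs L v) ((e j t : ↥((⟨T j, hTC j⟩ : ↥Car) : Subgroup (Gqs L v))) : Gqs L v) :=
    fun j t => (isStablyConjGAt_iff_exists_conj_eq _ _).2 ⟨_, (he j t).symm⟩
  refine ⟨fun j => ⟨T j, hTC j⟩, e, hS, fun j t _ => cartanWeight_eq_of_isStablyConjGAt hiM (hτM j) (hS j t), fun t hreg => ?_,
    ⟨P, g, x, δ, hP, hgU, hgNT, hδval, hTx, he⟩⟩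
  -- (B) at a regular `t ∈ T_i`
  have ht : (t : Gqs L v) ∈ Subgroup.centralizer ({γ₀} : Set (Gqs L v)) := by rw [← hi]; exact t.2
  have haU : ∀ j, g j * (t : Gqs L v).val * (g j)⁻¹ ∈ unitaryGroupOfForm (conjLocal L (IsCMField.complexConj L) v) (cmLocalForm L 3 v) := by
    intro j; rw [unitaryGroupOfForm_cmLocalForm_eq_unitaryGroup]; exact conj_mem_unitaryGroup_of_mem_centralizer hns hP hu hu1 (hgU j) ht
  have haex : ∀ j, ∃ b : Gqs L v, b.val = g j * (t : Gqs L v).val * (g j)⁻¹ := fun j => ⟨⟨g j * (t : Gqs L v).val * (g j)⁻¹, haU j⟩, rfl⟩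
  choose a haval using haex
  have hxU : ∀ j, (x j).val ∈ unitaryGroup (conjLocal L (IsCMField.complexConj L) v) (cmLocalForm L 3 v) := by
    intro j; rw [← unitaryGroupOfForm_cmLocalForm_eq_unitaryGroup]; exact (x j).2
  have hcls : ∀ j, ConjClasses.mk ((e j t : ↥((⟨T j, hTC j⟩ : ↥Car) : Subgroup (Gqs L v))) : Gqs L v) = ConjClasses.mk (a j) := by
    intro j
    refine conjClassesMk_eq_of_exists_unitary_conj ⟨(x j).val, hxU j, ?_⟩
    rw [he j t, haval]; group
  refine ⟨fun j _ => ?_, fun j _ k _ hjk => ?_, fun c hc => ?_⟩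
  · -- MapsTo: `t ∼_{st} e j t ∼ out ⟦e j t⟧`
    have h2 : IsStablyConjGAt L (R90.S4.splitFormGL L) v ((e j t : ↥((⟨T j, hTC j⟩ : ↥Car) : Subgroup (Gqs L v))) : Gqs L v)
        (Quotient.out (ConjClasses.mk ((e j t : ↥((⟨T j, hTC j⟩ : ↥Car) : Subgroup (Gqs L v))) : Gqs L v))) := mk_mem_stableIndexSet _
    show IsStablyConjGAt L (R90.S4.splitFormGL L) v (t : Gqs L v)
      (Quotient.out (ConjClasses.mk ((e j t : ↥((⟨T j, hTC j⟩ : ↥Car) : Subgroup (Gqs L v))) : Gqs L v)))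
    exact IsConj.trans (hS j t) h2
  · -- InjOn: ★ F3a `eq_of_unitary_conj_realisers`
    have hjk' : ConjClasses.mk (a j) = ConjClasses.mk (a k) := by rw [← hcls j, ← hcls k]; exact hjk
    obtain ⟨w', hw'U, hw'⟩ := exists_unitary_conj_of_conjClassesMk_eq hjk'
    rw [haval, haval] at hw'
    exact eq_of_unitary_conj_realisers hns hP hu hu1 _ (fun j k h => typeOneSign_injective j k h) g hgU hgNT ht hreg ⟨w', hw'U, hw'⟩
  · -- SurjOn: ★ F3a `exists_realiser_unitary_conj_of_isStablyConjGAt`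
    obtain ⟨j, w', hw'U, hw'⟩ := exists_realiser_unitary_conj_of_isStablyConjGAt hns hP hu hu1 _ exists_typeOneSign_eq g hgU hgNT ht hreg hc
    rw [← haval] at hw'
    refine ⟨j, Set.mem_univ _, ?_⟩
    show ConjClasses.mk ((e j t : ↥((⟨T j, hTC j⟩ : ↥Car) : Subgroup (Gqs L v))) : Gqs L v) = c
    rw [hcls j, conjClassesMk_eq_of_exists_unitary_conj ⟨w', hw'U, hw'⟩, ← ConjClasses.quotient_mk_eq_mk, Quotient.out_eq]

end TypeOnePackage

end Summit.HodgeConjecture.HodgeConjecture.R90.S4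

end
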